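import Literature.Computability.Cryptography.ShorModExpProgram
import Literature.Computability.Cryptography.OrderFindingPostSpec
import Literature.Computability.QuantumComplexity.RevUncompute
import HarnessLib

/-!
# Kitaev's order-finding family: the clean modular-exponentiation block and its semantics

Family `PQC`; towards the named fact `Kitaev1995_orderFindingFamily` of
`ShorOrderFindingQuantum.lean` (one of the named facts of `ShorTheoremAssembly.FACT_mem_BQP_of_facts`):
Kitaev's family around a *clean reversible modular-exponentiation block* exists, is polynomial-time
uniform, and on every on-promise instance the block maps `|w⟩|y⟩|0…0⟩` to `|w⟩|y⟩|R y⟩` with a work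
register `R y` that determines and is determined by the residues `x^{A_t(y)} mod n`.

This file constructs the block and proves everything but the uniformity:

* the machine of the block (`MB`, `eB`: the polynomial-time machine of `ModExpBlock.blockFn`,
  `ShorModExpProgram.lean`, through `RevClean.exists_outputsWithin_pow_of_mem_FP`), the layout
  (`dataN ℓ = ℓ + numControls ℓ` data wires — the instance `w` and the controls `y` —, the constant
  suffix `sufV ℓ = 0 1^ℓ`, `mW ℓ` work wires) and **the block `VB ℓ`**: the Clifford+T compilation
  (`revCompile`, Nielsen–Chuang Fig. 4.9) of Bennett's compute–copy–uncompute block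
  `RevClean.cleanOps` (`RevUncompute.lean`; Shor 1997, §3, p. 8: "once the output `F(x)` has been
  computed, copy it into a register that has been preset to zero, and then undo the computation";
  Kitaev 1995, §2.2, Lemma 1) of that machine; `VB_isOracleFree`;
* **semantics** `VB_mulVec_basisState`: `VB |w⟩|y⟩|0^{mW}⟩ = |w⟩|y⟩|resOf w y⟩`, the work register
  holding the read-out (`RevClean.readOut`) of the coded list of the four residues and zeros
  (`RevClean.clEval_cleanOps`, `revCompile_mulVec_basisState`);
* **the work register determines and is determined by the residues** `resOf_eq_iff` (injectivity of
  the read-out, `RevClean.eq_of_readOut_eq`, and `ModExpBlock.blockFn_wellFormed`), with the layout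
  identity `trialExp_eq_levelExp` (Kitaev's trial exponents `A_t(y) = ∑_{trial j = t} y_j 2^{level j}`
  are the Horner sums `ModExpBlock.levelExp` over the control stream);
* the remaining **named programming fact** `kitaevModExpFamily_isUniform` (the description of
  `kitaevFamily mW VB` — Hadamard layers, the block forwards and backwards, the phase layer — is
  printed in polynomial time; cf. `RevUncomputeUniform.lean`, `SimUniformity.lean`) and
  **`Kitaev1995_orderFindingFamily_of : kitaevModExpFamily_isUniform → Kitaev1995_orderFindingFamily`**.

## References

* P. W. Shor, *Polynomial-time algorithms for prime factorization and discrete logarithms on a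
  quantum computer*, SIAM J. Comput. 26 (1997) 1484–1509, §3 (pp. 8–10 of arXiv:quant-ph/9508027v2).
* A. Yu. Kitaev, *Quantum measurements and the Abelian Stabilizer Problem*, arXiv:quant-ph/9511026
  (1995), §2.2 Lemma 1, §4 (p. 15: uniformity).
* C. H. Bennett, *Logical reversibility of computation*, IBM J. Res. Develop. 17 (1973), §2.
* M. A. Nielsen, I. L. Chuang, *Quantum Computation and Quantum Information*, CUP 2010, §3.2.5, §4.3.
-/

noncomputable section

namespace Literature.Computability.Cryptography

namespace ModExpBlock

open _root_.Computability Complexity QuantumComplexity QuantumComplexity.RevClean QuantumComplexity.RevSim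
  Kitaev1995 OFPostCF Matrix Finset

/-! ### The machine of the block -/

/-- A polynomial-time machine of `blockFn` with a time bound of the shape `(n+2)^e`. [folklore] -/
theorem exists_blockMachine : ∃ p : (_ : ℕ) × Turing.TM2ComputableAux Bool Bool,
    ∀ u : List Bool, p.2.OutputsWithin u (blockFn u) (Tn p.1 u.length) := by
  obtain ⟨e, M, h⟩ := exists_outputsWithin_pow_of_mem_FP blockFn_mem_FP
  exact ⟨⟨e, M⟩, h⟩

/-- The exponent of the time bound of the block machine. [folklore] -/
def eB : ℕ := (Classical.choose exists_blockMachine).1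

/-- **The block machine** (a `TM2` machine computing `blockFn` within `(n+2)^{eB}` steps). [folklore] -/
def MB : Turing.TM2ComputableAux Bool Bool := (Classical.choose exists_blockMachine).2

/-- The block machine computes `blockFn` within its time bound. [folklore] -/
theorem MB_outputsWithin (u : List Bool) : MB.OutputsWithin u (blockFn u) (Tn eB u.length) :=
  Classical.choose_spec exists_blockMachine u

/-! ### The layout -/

/-- Data wires: the instance `w` (`ℓ` wires) and the controls `y`. [folklore] -/
def dataN (ℓ : ℕ) : ℕ := ℓ + numControls ℓ

/-- The constant suffix `0 1^ℓ` written behind the data (the format delimiter of `blockFn`). [folklore] -/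
def sufV (ℓ : ℕ) : List Bool := false :: ones ℓ

/-- The tableau input length: data plus suffix. [folklore] -/
def tabN (ℓ : ℕ) : ℕ := dataN ℓ + (sufV ℓ).length

/-- The total number of wires of the block. [folklore] -/
def totN (ℓ : ℕ) : ℕ := width eB MB (tabN ℓ)

/-- The number of work wires of the block. [folklore] -/
def mW (ℓ : ℕ) : ℕ := totN ℓ - dataN ℓ

/-- The data wires lie before the work wires. [folklore] -/
theorem dataN_le_totN (ℓ : ℕ) : dataN ℓ ≤ totN ℓ :=
  ((Nat.le_add_right _ _).trans (le_NN (e := eB) (M := MB) (tabN ℓ))).trans (NN_le_width _)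

/-- Kitaev's layout has the width of the block. [folklore] -/
theorem layoutN_eq (ℓ : ℕ) : ℓ + (numControls ℓ + mW ℓ) = totN ℓ := by
  have := dataN_le_totN ℓ; unfold mW dataN at *; omega

/-- There is a wire. [folklore] -/
theorem layoutN_pos (ℓ : ℕ) : 0 < ℓ + (numControls ℓ + mW ℓ) := by
  rw [layoutN_eq]; exact (NN_pos eB MB _).trans_le (NN_le_width _)

/-! ### The block -/

/-- The clean block on `ℕ`-indexed wires. [cite: Shor1997, §3 p.8 (compute F(x) keeping x, copy, undo)] -/
def opsN (ℓ : ℕ) : List (ClOp ℕ) := cleanOps eB MB (dataN ℓ) (sufV ℓ)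

/-- The block uses wires of the layout only. [folklore] -/
theorem opsN_lt (ℓ : ℕ) : ∀ op ∈ opsN ℓ, ∀ i ∈ wiresOf op, i < ℓ + (numControls ℓ + mW ℓ) := by
  rw [layoutN_eq]; exact cleanOps_lt

/-- The clean block on the wires of the layout. [folklore] -/
def opsFinB (ℓ : ℕ) : List (ClOp (Fin (ℓ + (numControls ℓ + mW ℓ)))) :=
  (opsN ℓ).map (ClOp.map (finOf _ (layoutN_pos ℓ)))

/-- The re-indexed block is well formed. [folklore] -/
theorem opsFinB_wf (ℓ : ℕ) : ∀ op ∈ opsFinB ℓ, op.WF := by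
  intro op hop
  simp only [opsFinB, List.mem_map] at hop
  obtain ⟨op, hop, rfl⟩ := hop
  exact wf_map_finOf _ (opsN_lt ℓ op hop) (cleanOps_wf op hop)

/-- **The modular-exponentiation block of Kitaev's family**: the exact Clifford+T compilation of
the clean reversible block of the machine of `blockFn`. [cite: Shor1997, §3 pp.8–10 (reversible modular exponentiation); Kitaev1995, §2.2 Lemma 1] -/
def VB (ℓ : ℕ) : QCircuit cliffordT (ℓ + (numControls ℓ + mW ℓ)) :=
  ⟨revCompile (toRevList (opsFinB ℓ) (opsFinB_wf ℓ))⟩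

/-- The block is oracle-free. [folklore] -/
theorem VB_isOracleFree (ℓ : ℕ) : (VB ℓ).IsOracleFree := revCompile_isOracleFree _

/-! ### Basis-state semantics -/

/-- The label `x y ρ` extended to `ℕ`. [folklore] -/
theorem liftW_tri {n k m : ℕ} (x : QReg n) (y : QReg k) (ρ : QReg m) (i : ℕ) :
    liftW (tri x y ρ) i = if h : i < n then x ⟨i, h⟩ else if h' : i < n + k then y ⟨i - n, by omega⟩
      else if h'' : i < n + (k + m) then ρ ⟨i - n - k, by omega⟩ else false := by
  unfold liftW
  by_cases h1 : i < n
  · rw [dif_pos (by omega), dif_pos h1]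
    exact tri_castAdd x y ρ ⟨i, h1⟩
  rw [dif_neg h1]
  by_cases h2 : i < n + k
  · rw [dif_pos (by omega), dif_pos h2]
    have : (⟨i, by omega⟩ : Fin (n + (k + m))) = coinWire n k m ⟨i - n, by omega⟩ := by
      ext; simp [val_coinWire]; omega
    rw [this, tri_coinWire]
  rw [dif_neg h2]
  by_cases h3 : i < n + (k + m)
  · rw [dif_pos h3, dif_pos h3]
    have : (⟨i, h3⟩ : Fin (n + (k + m))) = Fin.natAdd n (Fin.natAdd k ⟨i - n - k, by omega⟩) := by
      ext; simp; omega
    rw [this, tri_work]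
  · rw [dif_neg h3, dif_neg h3]

/-- The coin input extended to `ℕ` is the string assignment of `w ++ y`. [folklore] -/
theorem liftW_coinInput (w : List Bool) {k m : ℕ} (y : QReg k) :
    liftW (coinInput (m := m) w.get y) = strW (w ++ List.ofFn y) := by
  funext i
  rw [coinInput_eq_tri, liftW_tri, strW]
  by_cases h1 : i < w.length
  · rw [dif_pos h1, List.getD_append _ _ _ _ h1, List.getD_eq_getElem _ _ h1]; rfl
  rw [dif_neg h1, List.getD_append_right _ _ _ _ (not_lt.1 h1)]
  by_cases h2 : i < w.length + k
  · rw [dif_pos h2, List.getD_eq_getElem _ _ (by simp; omega), List.getElem_ofFn]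
  · rw [dif_neg h2, List.getD_eq_default _ _ (by simp; omega)]
    split_ifs <;> rfl

/-- The tableau input of the block on instance `w` and controls `y`. [folklore] -/
def inpOf (w : List Bool) (y : QReg (numControls w.length)) : List Bool := w ++ List.ofFn y ++ sufV w.length

/-- The tableau input has length `tabN`. [folklore] -/
theorem length_inpOf (w : List Bool) (y : QReg (numControls w.length)) : (inpOf w y).length = tabN w.length := by
  simp [inpOf, tabN, dataN, Nat.add_assoc]

/-- **The work register** of the block's output on `|w⟩|y⟩|0…0⟩`: the read-out code of
`blockFn (w ++ y ++ 0 1^ℓ)` on the result wires, zeros elsewhere. [folklore] -/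
def resOf (w : List Bool) (y : QReg (numControls w.length)) : QReg (mW w.length) :=
  fun j => readOut eB MB (tabN w.length) (blockFn (inpOf w y)) (dataN w.length + j)

/-- **Semantics of the block on basis inputs**: `VB |w⟩|y⟩|0^{mW}⟩ = |w⟩|y⟩|resOf w y⟩` (Bennett's
compute–copy–uncompute, `RevClean.clEval_cleanOps`, compiled exactly, `revCompile_mulVec_basisState`).
[cite: Shor1997, §3 p.8 (compute F(x) keeping x, copy, undo); Kitaev1995, §2.2 Lemma 1] -/
theorem VB_mulVec_basisState (w : List Bool) (y : QReg (numControls w.length)) :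
    (VB w.length).toMatrix 0 *ᵥ basisState (coinInput w.get y) = basisState (tri w.get y (resOf w y)) := by
  rw [VB, revCompile_mulVec_basisState]
  congr 1
  have hM := MB_outputsWithin (inpOf w y)
  rw [length_inpOf, tabN, inpOf, show dataN w.length = (w ++ List.ofFn y).length by simp [dataN]] at hM
  have key : ∀ p : Fin (w.length + (numControls w.length + mW w.length)),
      revEval (toRevList (opsFinB w.length) (opsFinB_wf w.length)) (coinInput w.get y) p =
        liftW (tri w.get y (resOf w y)) p := by
    intro p
    rw [revEval_toRevList, opsFinB, clEval_map_finOf_apply _ _ (opsN_lt _), liftW_coinInput, opsN,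
      show dataN w.length = (w ++ List.ofFn y).length by simp [dataN], clEval_cleanOps _ _ _ hM, liftW_tri]
    dsimp only
    have hp := p.isLt
    by_cases h1 : (p : ℕ) < w.length
    · rw [if_pos (by simp; omega), dif_pos h1, List.getD_append _ _ _ _ h1, List.getD_eq_getElem _ _ h1]; rfl
    rw [dif_neg h1]
    by_cases h2 : (p : ℕ) < w.length + numControls w.length
    · rw [if_pos (by simpa using h2), dif_pos h2, List.getD_append_right _ _ _ _ (not_lt.1 h1),
        List.getD_eq_getElem _ _ (by simp; omega), List.getElem_ofFn]
    · rw [if_neg (by simpa using h2), dif_neg h2, dif_pos hp, resOf, inpOf]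
      simp only [List.length_append, List.length_ofFn, tabN, dataN]
      congr 1
      omega
  funext p
  rw [key, liftW_val]

/-! ### Kitaev's trial exponents are the Horner sums of the control stream -/

/-- `levelExp` as a sum over the levels. [folklore] -/
theorem levelExp_eq_sum (m : ℕ) : ∀ (k : ℕ) (S : List Bool),
    levelExp m k S = ∑ l ∈ range k, 2 ^ l * ((S.drop (l * m)).take m).count true
  | 0, S => by simp [levelExp]
  | k + 1, S => by
    rw [levelExp, levelExp_eq_sum m k (S.drop m), sum_range_succ', mul_sum]
    simp only [List.drop_drop, pow_zero, one_mul, zero_mul, List.drop_zero]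
    rw [Nat.add_comm]
    congr 1
    refine sum_congr rfl fun l _ => ?_
    rw [pow_succ, show m + l * m = (l + 1) * m by ring]
    ring

/-- A sum over `Fin (2B)` as a sum over the two halves `Bool × Fin B`. [folklore] -/
theorem sum_fin_two_mul {B : ℕ} (f : ℕ → ℕ) :
    ∑ i : Fin (2 * B), f i = ∑ p : Bool × Fin B, f (p.1.toNat * B + p.2) := by
  rw [← Equiv.sum_comp ((Equiv.prodCongr finTwoEquiv.symm (Equiv.refl (Fin B))).trans finProdFinEquiv)]
  refine Fintype.sum_congr _ _ fun p => ?_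
  obtain ⟨b, i⟩ := p
  simp only [Equiv.trans_apply, Equiv.prodCongr_apply, Prod.map_apply, Equiv.coe_refl, id_eq,
    finProdFinEquiv_apply_val, val_finTwoEquiv_symm]
  congr 1
  ring

/-- **Kitaev's trial exponent is the Horner sum of the block machine**:
`∑_{trial j = t} y_j 2^{level j} = levelExp (2B) L (y after t trials)`.
[cite: Kitaev1995, §3 (Lemma 10: the powers U^(2^l)); Shor1997, §3 p.9 (repeated squaring)] -/
theorem trialExp_eq_levelExp (ℓ : ℕ) (y : QReg (numControls ℓ)) (t : Fin numTrials) :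
    trialExp (trialOf ℓ) (levels ℓ) t y =
      levelExp (2 * blockSize ℓ) (numLevels ℓ) ((List.ofFn y).drop (t * (numLevels ℓ * (2 * blockSize ℓ)))) := by
  classical
  -- the Horner sum, window by window
  rw [levelExp_eq_sum, sum_range]
  simp only [List.drop_drop, count_take_drop_eq_sum]
  -- the trial sum, reindexed by the layout
  rw [trialExp, sum_filter, ← Equiv.sum_comp (layout ℓ).symm]
  simp only [trialOf, levels, levelOf, Equiv.apply_symm_apply]
  rw [Fintype.sum_prod_type, Finset.sum_eq_single t (fun t' _ ht' => by simp [ht']) (by simp)]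
  simp only [if_true]
  rw [Fintype.sum_prod_type]
  refine sum_congr rfl fun l _ => ?_
  rw [Fintype.sum_prod_type, mul_sum,
    sum_fin_two_mul (f := fun i => 2 ^ (l : ℕ) * ((List.ofFn y).getD (↑t * (numLevels ℓ * (2 * blockSize ℓ)) + ↑l * (2 * blockSize ℓ) + i) false).toNat),
    Fintype.sum_prod_type]
  refine sum_congr rfl fun σ _ => sum_congr rfl fun i _ => ?_
  rw [Nat.mul_comm (2 ^ (l : ℕ))]
  congr 2
  have hv := val_layout_symm t l σ i
  have hlt := ((layout ℓ).symm (t, l, σ, i)).isLt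
  rw [List.getD_eq_getElem _ _ (by simp; omega), List.getElem_ofFn]
  congr 1
  ext
  rw [hv]
  ring

/-! ### The work register determines and is determined by the residues -/

/-- `encList` is injective. [folklore] -/
theorem encList_injective : Function.Injective encList := by
  intro l₁
  induction l₁ with
  | nil =>
    intro l₂ h
    cases l₂ with
    | nil => rfl
    | cons a l₂ => exact absurd h.symm (QCircuit.boolPair_ne_nil _ _)
  | cons a l₁ ih =>
    intro l₂ h
    cases l₂ with
    | nil => exact absurd h (QCircuit.boolPair_ne_nil _ _)
    | cons b l₂ =>
      rw [encList_cons, encList_cons] at h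
      obtain ⟨rfl, h2⟩ := QCircuit.boolPair_inj h
      rw [ih h2]

/-- The residue of trial `t` on instance `⟨x, n⟩` with controls `y`. [cite: Shor1997, §3 (modular exponentiation)] -/
def residue (x n : ℕ) (y : QReg (numControls (encodeOrderInstance x n).length)) (t : ℕ) : ℕ :=
  x ^ levelExp (2 * blockSize (encodeOrderInstance x n).length) (numLevels (encodeOrderInstance x n).length)
    ((List.ofFn y).drop (t * (numLevels (encodeOrderInstance x n).length * (2 * blockSize (encodeOrderInstance x n).length)))) % n

/-- **The block machine on the block's tableau input** writes the coded list of the four residues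
(`ModExpBlock.blockFn_wellFormed`, with `2B = 12288 (2ℓ+1)` and `L = 2ℓ+1`). [cite: Shor1997, §3 pp.8–10] -/
theorem blockFn_inpOf (x n : ℕ) (hn : 1 < n) (y : QReg (numControls (encodeOrderInstance x n).length)) :
    blockFn (inpOf (encodeOrderInstance x n) y) = encList ((List.range 4).map fun t => encodeNat (residue x n y t)) := by
  have h := blockFn_wellFormed x n hn (List.ofFn y)
  have h2B : 2 * blockSize (encodeOrderInstance x n).length = 12288 * (2 * (encodeOrderInstance x n).length + 1) := by
    unfold blockSize numLevels; ring
  have hL : numLevels (encodeOrderInstance x n).length = 2 * (encodeOrderInstance x n).length + 1 := rfl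
  rw [inpOf, sufV, h]
  simp only [residue, h2B, hL]

/-- The whole read-out of the block's output is determined by the work register. [folklore] -/
theorem readOut_eq_of_resOf_eq {w : List Bool} {y y' : QReg (numControls w.length)} (h : resOf w y = resOf w y') :
    readOut eB MB (tabN w.length) (blockFn (inpOf w y)) = readOut eB MB (tabN w.length) (blockFn (inpOf w y')) := by
  funext i
  have hNN : tabN w.length ≤ NN eB MB (tabN w.length) := le_NN _
  have htab : dataN w.length ≤ tabN w.length := Nat.le_add_right _ _
  have hwid : totN w.length = NN eB MB (tabN w.length) + copyN eB MB (tabN w.length) := rfl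
  by_cases h1 : i < dataN w.length
  · rw [readOut, readOut, if_neg (by omega), if_neg (by omega)]
  · by_cases h2 : i < totN w.length
    · have := congrFun h ⟨i - dataN w.length, by unfold mW; omega⟩
      simp only [resOf] at this
      rwa [show dataN w.length + (i - dataN w.length) = i by omega] at this
    · rw [readOut, readOut, if_neg (by omega), if_neg (by omega)]

/-- **The work register determines and is determined by the residues.** [cite: Shor1997, §3 (the block computes x^A mod n with no garbage); Kitaev1995, §2.2 Lemma 1] -/
theorem resOf_eq_iff (x n : ℕ) (hn : 1 < n) (y y' : QReg (numControls (encodeOrderInstance x n).length)) :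
    resOf (encodeOrderInstance x n) y = resOf (encodeOrderInstance x n) y' ↔
      ∀ t, x ^ trialExp (trialOf _) (levels _) t y ≡ x ^ trialExp (trialOf _) (levels _) t y' [MOD n] := by
  have hres : ∀ (z : QReg (numControls (encodeOrderInstance x n).length)) (t : Fin numTrials),
      x ^ trialExp (trialOf _) (levels _) t z % n = residue x n z t := fun z t => by
    rw [residue, trialExp_eq_levelExp]
  constructor
  · intro h t
    have hro := readOut_eq_of_resOf_eq h
    have h₁ := MB_outputsWithin (inpOf (encodeOrderInstance x n) y)
    have h₂ := MB_outputsWithin (inpOf (encodeOrderInstance x n) y')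
    rw [length_inpOf] at h₁ h₂
    have hl := eq_of_readOut_eq (length_inpOf _ y) (length_inpOf _ y') h₁ h₂ hro
    rw [blockFn_inpOf x n hn y, blockFn_inpOf x n hn y'] at hl
    have hl' := List.map_eq_map_iff.1 (encList_injective hl) t (List.mem_range.2 t.isLt)
    have heq : residue x n y t = residue x n y' t := QCircuit.encodeNat_injective hl'
    rw [Nat.ModEq, hres, hres, heq]
  · intro h
    have hl : blockFn (inpOf (encodeOrderInstance x n) y) = blockFn (inpOf (encodeOrderInstance x n) y') := by
      rw [blockFn_inpOf x n hn y, blockFn_inpOf x n hn y']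
      refine congrArg encList (List.map_congr_left fun t ht => ?_)
      have ht4 : t < numTrials := List.mem_range.1 ht
      have := h ⟨t, ht4⟩
      rw [Nat.ModEq, hres, hres] at this
      exact congrArg encodeNat this
    funext j
    change readOut eB MB _ (blockFn (inpOf _ y)) _ = readOut eB MB _ (blockFn (inpOf _ y')) _
    rw [hl]

/-! ### The named programming fact and the reduction of `Kitaev1995_orderFindingFamily` to it -/

/-- **Named programming fact: Kitaev's family around the modular-exponentiation block is
polynomial-time uniform** — the description of `kitaevFamily mW VB` (header; a Hadamard gate on
each control wire; the clean block `cleanOps`: suffix `NOT`s, the tableau of `MB` forwards, the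
read-out fan-out, the tableau backwards, suffix `NOT`s, each gate an exact Clifford+T word; `S³` on
the sine-test control wires; the Hadamard layer again) is printed from `1^ℓ` in polynomial time
(Shor 1997, §2, p. 7: "the design of the gate array be produced by a polynomial-time (classical)
computation"; Kitaev 1995, §4, p. 15: "our procedure is uniform"; the generator toolkit of
`RevTableauUniform.lean`/`RevUncomputeUniform.lean`, cf. `SimUniformity.lean` for the analogous
coin family). [cite: Shor1997, §2 p.7 (uniformity of the gate array); Kitaev1995, §4 p.15] -/
def kitaevModExpFamily_isUniform : Prop := (kitaevFamily mW VB).IsUniform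

/-- **`Kitaev1995_orderFindingFamily` from the programming fact**: the family around the block
`VB` is oracle-free (`VB_isOracleFree`), uniform by hypothesis, and on every on-promise instance the
block maps `|w⟩|y⟩|0^{mW}⟩` to `|w⟩|y⟩|resOf w y⟩` (`VB_mulVec_basisState`) with a work register that
determines and is determined by the residues (`resOf_eq_iff`). [cite: Shor1997, §3 p.8 (reversible computation of poly-time F keeping x, erasing garbage); Kitaev1995, §2.2 Lemma 1] -/
theorem _root_.Literature.Computability.Cryptography.Kitaev1995_orderFindingFamily_of
    (h : kitaevModExpFamily_isUniform) : Kitaev1995_orderFindingFamily :=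
  ⟨mW, VB, VB_isOracleFree, h, fun x n hn _ =>
    ⟨resOf (encodeOrderInstance x n), fun y => VB_mulVec_basisState _ y, fun y y' => resOf_eq_iff x n hn y y'⟩⟩

end ModExpBlock

end Literature.Computability.Cryptography

end
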